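import Summits.QuantumFields.BalabanUV.T4Continuum.Spine.NE1p.DressedSourceAnalyticOnCores
import Summits.QuantumFields.BalabanUV.T4Continuum.Spine.NE1p.DressedSmallFieldGeometryFaces

/-!
# T⁴ programme, spine estimate NE1′ (node O3b/H2) — THE SOURCE-ANALYTIC SMALL-FIELD ENDs OF S33 ON THE TORUS OF THE PAPERS:
# holomorphy in the source + the μ-uniform (2.41) envelope and the linear response of the dressed output built from (2.14)-cores
# with term-dependent polymer families, and of the substrate's slot activities, at pv22's `tgeometry 4 N` — NO geometry
# hypothesis, constants LOCATED as numerals (ν = 9, κ₀ = 64·log 162, K₀ = K₀(64,8), c₁ = 64, b = 5·r₁)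

Cell `pub-balaban`, sub-cell `t4`, BINDER-OWNERS row NE1′; NE1′ formalisation crew, unit `b2b-balaban-t4-ne1p-formalise-leaf-03`
(LEAF PROVER 03, generation 12); crew row S⟨next⟩ of `t4/formal/NE1p/LEAVES.md` (follower of the unit's own S33 in its own scope).
ADDITIVE — imports S33 `Spine/NE1p/DressedSourceAnalyticOnCores` (→ N0r, N0n) and S24 `Spine/NE1p/DressedSmallFieldGeometryFaces`
(`K₀_four`; → N0o `torus_consts`) ONLY; THEOREMS ONLY (0 def, 0 `def … : Prop`, 0 cite); nothing of S33 ∕ N0n–N0r ∕ S24 ∕ row NE5 ∕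
the substrate ∕ pv22 is restated — their declarations are used BY NAME.

WHY THIS FILE.  S33 fired N0n's parametric-analyticity END and N0j's linear-response END with (B1a) discharged over a general
`B13Resummation.Geometry`; every other small-field END of the crew has, next to its `Geometry` form, a TORUS form at pv22's
CONSTRUCTED carrier geometry `tgeometry 4 N` with the (B4) group discharged BY NAME and the (B5) clauses located as numerals (S24 §2,
S25 §2, S27–S29, S31).  This file supplies the torus forms of S33 §2–§4:
* §0 (exp-linear families read along a table map `hc : P → Hist` from ANY complex normed `P`, open `S ⊆ P`):
  `analytic_and_bounded_locE_param_of_expLinear_torus` (S33 §2 ONCE BY NAME; at `P := ℂ × B`, `S := ball 0 μ₁ ×ˢ W` the JOINT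
  (source, background) face on the torus with (E1)∕(E2) discharged).
* §1 (cores with term-dependent polymer families, SOURCE pencil `h₀ + s • v`, (B3) as N0q's letter budget):
  `analytic_and_bounded_locE_of_coresAt_pencil_mass_torus` ∕ `muDeriv_locE_le_of_coresAt_pencil_mass_torus` (S33 §3 ONCE each BY
  NAME at `D := tsys 4 N`, `G := tgeometry 4 N`, `b₅ := 5·r₁`; constants by `torus_consts` ∕ `K₀_four`).
* §2 (the substrate's slot activities `actOfLetters ℓ`, `hact` by `rfl` inside S33): `analytic_and_bounded_locE_of_actOfLetters_torus`
  ∕ `muDeriv_locE_le_of_actOfLetters_torus` (S33 §4 ONCE each BY NAME).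
Conclusions in the crew's torus currency: `s ↦ E[act s](X₀)` complex differentiable on `‖s‖ < μ₁` and bounded there by
`e·9·64·K₀(64,8)²·A·e^{−r₁·torusTreeLen X₀}` (S24 `norm_locE_le_torus` ∕ S25 `analytic_and_bounded_locE_param_torus`'s RHS); the
source derivative on `‖sμ‖ ≤ μ₀ < μ₁` is `≤ 2·(e·9·64·K₀(64,8)²·A·e^{−r₁·torusTreeLen X₀})∕(μ₁ − μ₀)` (S24 `muDeriv_locE_le_torus`'s
RHS).  Binder census vs S33 §3∕§4: MINUS [D, Cube, G, b₅, hb], PLUS [N, [NeZero N]]; CHANGED = the torus dictionary only (`G.κ₀ ↦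
64·log 162`, `G.K₀·G.ν·G.c₁ ↦ K₀ 64 8 · 9 · 64` with `b₅ ↦ 5·r₁`, `G.cubes Z ⊆ G.cubes X₀ ↦ Z.1 ⊆ X₀.1`, `D.dj ↦ torusTreeLen ·.1`).
S33's import cone carries no `TwoRuns` instance (N0r → `SubstrateActivities` only, as S29's), so the bare `locE (TTouch …)` text
elaborates classically exactly as S27–S29's — no `(Dom := …)` pin needed (crew note R-T123 (vii)).

HONEST FRAMING.  By-name kernel composition: S33's ENDs re-socketed on pv22's CONSTRUCTED torus ((B4) discharged BY NAME there; pv22's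
READING of 𝐃_{k+1}∕d_{k+1} (D-pv22.3) not asserted); (B1a) kernel as in S33; (B1b)'s residue (`terms`∕`emb`∕`hscale`), (B3) = `hM3`
(G-ne9p2-5 UNPRINTED, shared with NE9), the operator-letter blocks, the located clause SHAPES «κ large» ∕ «ε₁ small» and `hO`∕`hH` stay
DISPLAYED; `9`, `64`, `64·log 162`, `K₀ 64 8` are pv22's PROVED constants entering BY NAME, `5·r₁` N0o's convention, `2` N0j's response
factor — no numeral of [Balaban1988RGII]; 0 binders instantiated on Bałaban's densities; no new inequality; no wall item; wall v1.7
(T4-DAG v43) does NOT move; R-t4r2-Q2 NOT met.  NE1′ ⇐ the named binders — NOT proved, NOT printed; spine PROVED 0∕9; count 9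
unchanged.  Rung (B)+1 on ONE finite four-torus — NOT infinite volume, NOT a mass gap, NOT OS on ℝ⁴, NOT Clay.  HONEST DEPENDENCY:
continuum YM on T⁴ ⇐ BetaPertH ∧ nine spine estimates (0/9 proved); BetaPertH ⇐ (D1) ∧ (D4) ∧ CAP+tail; G-an2-4 gates asym, D1 and
NE2/3/4.
-/

noncomputable section

namespace Summit.QuantumFields.BalabanUV.T4Continuum.NE1p.DressedSourceAnalyticOnCoresTorus

open Metric Set Complex MeasureTheory
open scoped BigOperators
open Literature.MathematicalPhysics.QuantumFieldTheory.Balaban1983to89.T4OutputRate (Carriers)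
open Literature.MathematicalPhysics.QuantumFieldTheory.Balaban1983to89.B13Resummation (locE)
open Literature.MathematicalPhysics.QuantumFieldTheory.Balaban1983to89.TreeLengthTorus (tsys torusTreeLen)
open Literature.MathematicalPhysics.QuantumFieldTheory.Balaban1983to89.TreeLengthTorusGeometry (TTouch tgeometry)
open Literature.MathematicalPhysics.QuantumFieldTheory.Balaban1983to89.B12TreeDecay (K₀)
open Summit.QuantumFields.BalabanUV.T4Continuum.B13HistMeasurable (MeasPotFrame B13HistM)
open Summit.QuantumFields.BalabanUV.T4Continuum.B13TermParamGaussianBi (BiCore)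
open Summit.QuantumFields.BalabanUV.T4Continuum.SubstrateActivities (CoreLetters coreOf actOfLetters)
open Literature.MathematicalPhysics.QuantumFieldTheory.Balaban1983to89.T4InputCauchyRateTermwise (TermHistExpLinear)
open Summit.QuantumFields.BalabanUV.T4Continuum.NE1p.DressedSourceAnalyticOnCores
  (analytic_and_bounded_locE_param_of_expLinear analytic_and_bounded_locE_of_coresAt_pencil_mass
  muDeriv_locE_le_of_coresAt_pencil_mass analytic_and_bounded_locE_of_actOfLetters muDeriv_locE_le_of_actOfLetters)
open Summit.QuantumFields.BalabanUV.T4Continuum.NE1p.DressedSmallFieldGeometry (torus_consts)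
open Summit.QuantumFields.BalabanUV.T4Continuum.NE1p.DressedSmallFieldGeometryFaces (K₀_four)

variable {N : ℕ} [NeZero N]

/-! ## §0 EXP-LINEAR FAMILIES READ ALONG A TABLE MAP FROM ANY PARAMETER SPACE, ON THE TORUS -/

section ExpLinear

variable {C : Carriers} {Op Hist : Type*} [NormedAddCommGroup Hist] [NormedSpace ℂ Hist] {ι : Type*}
  {K : ℕ → (ℕ → ℝ) → C.BgB → Set (Op × Hist)} {T : ℕ → ι → Op → Hist → C.Dom → ℂ}
  {W : Set (ℕ → ℝ)} {α : ℕ → ι → Type*} [∀ k i, MeasurableSpace (α k i)] {μ : ∀ k i, Op → C.Dom → Measure (α k i)}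
  {Φ : ∀ k i, Op → C.Dom → α k i → ℂ} {Λ : ∀ k i, Op → C.Dom → α k i → (Hist →L[ℂ] ℂ)}
  {P : Type*} [NormedAddCommGroup P] [NormedSpace ℂ P]

open Classical in
/-- **THE DRESSED OUTPUT IS HOLOMORPHIC IN ANY PARAMETER IN WHICH THE TABLE IS, AND BOUNDED BY THE (2.41) ENVELOPE, ON THE TORUS —
(B1a) DISCHARGED, NO GEOMETRY HYPOTHESIS** (kernel; S33 §2 `analytic_and_bounded_locE_param_of_expLinear` ONCE BY NAME at `tsys 4 N` ∕
`tgeometry 4 N`, `b₅ := 5·r₁`, constants located by `torus_consts` ∕ `K₀_four`; at `P := ℂ × B`, `S := ball 0 μ₁ ×ˢ W` the JOINT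
(source, background) face on the torus — S25 `differentiableOn_locE_source_background_torus`'s content with (E1)∕(E2) discharged).
[folklore] -/
theorem analytic_and_bounded_locE_param_of_expLinear_torus (hexp : TermHistExpLinear K T W μ Φ Λ) {k : ℕ} {g : ℕ → ℝ}
    (hg : g ∈ W) {U : C.BgB} {o : Op} {hc : P → Hist} {S : Set P} (hS : IsOpen S) {R₀ : ℝ}
    (hcurve : DifferentiableOn ℂ hc S) (hK : ∀ p ∈ S, (o, hc p) ∈ K k g U) (hR : ∀ p ∈ S, ‖hc p‖ ≤ R₀)
    {emb : (tsys 4 N).Dom → C.Dom} (hscale : ∀ Z, C.scale (emb Z) = k) {terms : (tsys 4 N).Dom → Finset ι}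
    {act : P → (tsys 4 N).Dom → ℂ} (hact : ∀ p ∈ S, ∀ Z, act p Z = ∑ i ∈ terms Z, T k i o (hc p) (emb Z))
    {N' : (tsys 4 N).Dom → ι → ℝ} (hN0 : ∀ Z i, 0 ≤ N' Z i)
    (hN : ∀ Z, ∀ i ∈ terms Z, ∀ᵐ a ∂μ k i o (emb Z), ‖Λ k i o (emb Z) a‖ ≤ N' Z i)
    {A R r₁ : ℝ} (X₀ : (tsys 4 N).Dom) (hA : 0 ≤ A) (hr₁ : 0 ≤ r₁)
    (hrate : r₁ + 2 * (64 * Real.log 162) + 2 ≤ R) (hsmall : A * Real.exp (5 * r₁ + 1) * K₀ 64 8 * 9 * 64 ≤ 1)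
    (hL3 : ∀ Z : (tsys 4 N).Dom, Z.1 ⊆ X₀.1 →
      ∑ i ∈ terms Z, (∫ a, ‖Φ k i o (emb Z) a‖ ∂μ k i o (emb Z)) * Real.exp (N' Z i * R₀) ≤
        A * Real.exp (-(R * torusTreeLen Z.1))) :
    DifferentiableOn ℂ (fun p => locE (TTouch (d := 4) (N := N)) (fun Z : (tsys 4 N).Dom => Z.1) (act p) X₀.1) S ∧
      ∀ p ∈ S, ‖locE (TTouch (d := 4) (N := N)) (fun Z : (tsys 4 N).Dom => Z.1) (act p) X₀.1‖ ≤
        Real.exp 1 * 9 * 64 * K₀ 64 8 ^ 2 * A * Real.exp (-(r₁ * torusTreeLen X₀.1)) := by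
  obtain ⟨hν, hκ, hc'⟩ := torus_consts N
  have hK₀ := K₀_four (N := N)
  have h := analytic_and_bounded_locE_param_of_expLinear (tsys 4 N) (tgeometry 4 N) hexp hg hS hcurve hK hR hscale hact hN0 hN
    (R := R) (b₅ := 5 * r₁) (X₀ := X₀) hA hr₁ (le_of_eq (by ring)) (by rw [hκ]; exact hrate)
    (by rw [hK₀, hν, hc']; exact hsmall) hL3
  rw [hν, hc', hK₀] at h
  exact h

end ExpLinear

/-! ## §1 CORES WITH TERM-DEPENDENT POLYMER FAMILIES ON THE TORUS -/

section Dep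

variable {C : Carriers} {P : MeasPotFrame C} {Op : Type*} [NormedAddCommGroup Op] [NormedSpace ℂ Op] {ι : Type*}
  {𝒴 : ℕ → ι → Type*} {dom : ∀ k i, 𝒴 k i → C.Dom} {β : ℕ → ι → Type*} [∀ k i, MeasurableSpace (β k i)]
  {α : ℕ → ι → Type*} [∀ k i, NormedAddCommGroup (α k i)] [∀ k i, InnerProductSpace ℝ (α k i)]
  [∀ k i, FiniteDimensional ℝ (α k i)] [∀ k i, MeasurableSpace (α k i)] [∀ k i, BorelSpace (α k i)]

open Classical in
/-- **HOLOMORPHY IN THE SOURCE + THE (2.41) ENVELOPE FOR CORES WITH TERM-DEPENDENT POLYMER FAMILIES, ON THE TORUS — NO GEOMETRY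
HYPOTHESIS** (kernel; S33 §3 `analytic_and_bounded_locE_of_coresAt_pencil_mass` ONCE BY NAME at `tsys 4 N` ∕ `tgeometry 4 N`, `b₅ := 5·r₁`,
constants located by `torus_consts` ∕ `K₀_four`). [folklore] -/
theorem analytic_and_bounded_locE_of_coresAt_pencil_mass_torus {W : Set (ℕ → ℝ)}
    {ctr : ℕ → (ℕ → ℝ) → C.BgB → Op × B13HistM P} {ROp RHist R' : ℕ → ℝ}
    (𝔊 : ∀ k i, C.Dom → BiCore P (dom k i) Op (β k i) (α k i)) {mq bq N₀ : ℕ → ι → C.Dom → ℝ} (hroom : ∀ k, ROp k < R' k)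
    (hm : ∀ k, ∀ g ∈ W, ∀ (U : C.BgB) (X : C.Dom), C.scale X = k → ∀ i, 0 < mq k i X)
    (hN : ∀ k, ∀ g ∈ W, ∀ (U : C.BgB) (X : C.Dom), C.scale X = k → ∀ i,
      (∀ o ∈ ball (ctr k g U).1 (R' k), AEStronglyMeasurable ((𝔊 k i X).N o) (𝔊 k i X).lam) ∧
      (∀ p, DifferentiableOn ℂ (fun o => (𝔊 k i X).N o p) (ball (ctr k g U).1 (R' k))) ∧
      (∀ o ∈ ball (ctr k g U).1 (R' k), ∀ p, ‖(𝔊 k i X).N o p‖ ≤ N₀ k i X))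
    (hq : ∀ k, ∀ g ∈ W, ∀ (U : C.BgB) (X : C.Dom), C.scale X = k → ∀ i,
      (∀ o ∈ ball (ctr k g U).1 (R' k),
        AEStronglyMeasurable (Function.uncurry ((𝔊 k i X).q o)) ((𝔊 k i X).lam.prod volume)) ∧
      (∀ p v, DifferentiableOn ℂ (fun o => (𝔊 k i X).q o p v) (ball (ctr k g U).1 (R' k))) ∧
      (∀ o ∈ ball (ctr k g U).1 (R' k), ∀ p v, mq k i X * ‖v‖ ^ 2 - bq k i X ≤ ((𝔊 k i X).q o p v).re))
    {k : ℕ} {g : ℕ → ℝ} (hg : g ∈ W) {U : C.BgB} {o : Op} {h₀ v : B13HistM P} {μ₁ : ℝ}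
    (hO : ‖o - (ctr k g U).1‖ ≤ ROp k) (hH : ‖h₀ - (ctr k g U).2‖ + μ₁ * ‖v‖ ≤ RHist k)
    {emb : (tsys 4 N).Dom → C.Dom} (hscale : ∀ Z, C.scale (emb Z) = k) {terms : (tsys 4 N).Dom → Finset ι}
    {act : ℂ → (tsys 4 N).Dom → ℂ}
    (hact : ∀ s ∈ ball (0 : ℂ) μ₁, ∀ Z, act s Z = ∑ i ∈ terms Z, (𝔊 k i (emb Z)).termAt o (h₀ + s • v))
    {A R r₁ : ℝ} (X₀ : (tsys 4 N).Dom) (hA : 0 ≤ A) (hr₁ : 0 ≤ r₁)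
    (hrate : r₁ + 2 * (64 * Real.log 162) + 2 ≤ R) (hsmall : A * Real.exp (5 * r₁ + 1) * K₀ 64 8 * 9 * 64 ≤ 1)
    (hM3 : ∀ Z : (tsys 4 N).Dom, Z.1 ⊆ X₀.1 →
      ∑ i ∈ terms Z, (𝔊 k i (emb Z)).lam.real univ * ((𝔊 k i (emb Z)).wB * N₀ k i (emb Z) *
          Real.exp (bq k i (emb Z))) * (Real.pi / (mq k i (emb Z) / 2)) ^ (Module.finrank ℝ (α k i) / 2 : ℝ) *
        Real.exp ((𝔊 k i (emb Z)).N₁ * (‖h₀‖ + μ₁ * ‖v‖)) ≤ A * Real.exp (-(R * torusTreeLen Z.1))) :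
    DifferentiableOn ℂ (fun s => locE (TTouch (d := 4) (N := N)) (fun Z : (tsys 4 N).Dom => Z.1) (act s) X₀.1)
        (ball (0 : ℂ) μ₁) ∧
      ∀ s ∈ ball (0 : ℂ) μ₁, ‖locE (TTouch (d := 4) (N := N)) (fun Z : (tsys 4 N).Dom => Z.1) (act s) X₀.1‖ ≤
        Real.exp 1 * 9 * 64 * K₀ 64 8 ^ 2 * A * Real.exp (-(r₁ * torusTreeLen X₀.1)) := by
  obtain ⟨hν, hκ, hc⟩ := torus_consts N
  have hK₀ := K₀_four (N := N)
  have h := analytic_and_bounded_locE_of_coresAt_pencil_mass (tsys 4 N) (tgeometry 4 N) 𝔊 hroom hm hN hq hg hO hH hscale hact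
    (R := R) (b₅ := 5 * r₁) (X₀ := X₀) hA hr₁ (le_of_eq (by ring)) (by rw [hκ]; exact hrate)
    (by rw [hK₀, hν, hc]; exact hsmall) hM3
  rw [hν, hc, hK₀] at h
  exact h

open Classical in
/-- **LINEAR RESPONSE FOR CORES WITH TERM-DEPENDENT POLYMER FAMILIES, ON THE TORUS — NO GEOMETRY HYPOTHESIS** (kernel; S33 §3
`muDeriv_locE_le_of_coresAt_pencil_mass` ONCE BY NAME at `tgeometry 4 N`, constants located): for `‖sμ‖ ≤ μ₀ < μ₁`,
`‖∂_s E[act s](X₀)|_{sμ}‖ ≤ 2·(e·9·64·K₀(64,8)²·A·e^{−r₁·torusTreeLen X₀})∕(μ₁ − μ₀)`. [folklore] -/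
theorem muDeriv_locE_le_of_coresAt_pencil_mass_torus {W : Set (ℕ → ℝ)}
    {ctr : ℕ → (ℕ → ℝ) → C.BgB → Op × B13HistM P} {ROp RHist R' : ℕ → ℝ}
    (𝔊 : ∀ k i, C.Dom → BiCore P (dom k i) Op (β k i) (α k i)) {mq bq N₀ : ℕ → ι → C.Dom → ℝ} (hroom : ∀ k, ROp k < R' k)
    (hm : ∀ k, ∀ g ∈ W, ∀ (U : C.BgB) (X : C.Dom), C.scale X = k → ∀ i, 0 < mq k i X)
    (hN : ∀ k, ∀ g ∈ W, ∀ (U : C.BgB) (X : C.Dom), C.scale X = k → ∀ i,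
      (∀ o ∈ ball (ctr k g U).1 (R' k), AEStronglyMeasurable ((𝔊 k i X).N o) (𝔊 k i X).lam) ∧
      (∀ p, DifferentiableOn ℂ (fun o => (𝔊 k i X).N o p) (ball (ctr k g U).1 (R' k))) ∧
      (∀ o ∈ ball (ctr k g U).1 (R' k), ∀ p, ‖(𝔊 k i X).N o p‖ ≤ N₀ k i X))
    (hq : ∀ k, ∀ g ∈ W, ∀ (U : C.BgB) (X : C.Dom), C.scale X = k → ∀ i,
      (∀ o ∈ ball (ctr k g U).1 (R' k),
        AEStronglyMeasurable (Function.uncurry ((𝔊 k i X).q o)) ((𝔊 k i X).lam.prod volume)) ∧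
      (∀ p v, DifferentiableOn ℂ (fun o => (𝔊 k i X).q o p v) (ball (ctr k g U).1 (R' k))) ∧
      (∀ o ∈ ball (ctr k g U).1 (R' k), ∀ p v, mq k i X * ‖v‖ ^ 2 - bq k i X ≤ ((𝔊 k i X).q o p v).re))
    {k : ℕ} {g : ℕ → ℝ} (hg : g ∈ W) {U : C.BgB} {o : Op} {h₀ v : B13HistM P} {μ₁ : ℝ}
    (hO : ‖o - (ctr k g U).1‖ ≤ ROp k) (hH : ‖h₀ - (ctr k g U).2‖ + μ₁ * ‖v‖ ≤ RHist k)
    {emb : (tsys 4 N).Dom → C.Dom} (hscale : ∀ Z, C.scale (emb Z) = k) {terms : (tsys 4 N).Dom → Finset ι}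
    {act : ℂ → (tsys 4 N).Dom → ℂ}
    (hact : ∀ s ∈ ball (0 : ℂ) μ₁, ∀ Z, act s Z = ∑ i ∈ terms Z, (𝔊 k i (emb Z)).termAt o (h₀ + s • v))
    {A R r₁ μ₀ : ℝ} (X₀ : (tsys 4 N).Dom) {sμ : ℂ} (hA : 0 ≤ A) (hr₁ : 0 ≤ r₁)
    (hrate : r₁ + 2 * (64 * Real.log 162) + 2 ≤ R) (hsmall : A * Real.exp (5 * r₁ + 1) * K₀ 64 8 * 9 * 64 ≤ 1)
    (hM3 : ∀ Z : (tsys 4 N).Dom, Z.1 ⊆ X₀.1 →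
      ∑ i ∈ terms Z, (𝔊 k i (emb Z)).lam.real univ * ((𝔊 k i (emb Z)).wB * N₀ k i (emb Z) *
          Real.exp (bq k i (emb Z))) * (Real.pi / (mq k i (emb Z) / 2)) ^ (Module.finrank ℝ (α k i) / 2 : ℝ) *
        Real.exp ((𝔊 k i (emb Z)).N₁ * (‖h₀‖ + μ₁ * ‖v‖)) ≤ A * Real.exp (-(R * torusTreeLen Z.1)))
    (h01 : μ₀ < μ₁) (hμ : ‖sμ‖ ≤ μ₀) :
    ‖deriv (fun s => locE (TTouch (d := 4) (N := N)) (fun Z : (tsys 4 N).Dom => Z.1) (act s) X₀.1) sμ‖ ≤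
      2 * (Real.exp 1 * 9 * 64 * K₀ 64 8 ^ 2 * A * Real.exp (-(r₁ * torusTreeLen X₀.1))) / (μ₁ - μ₀) := by
  obtain ⟨hν, hκ, hc⟩ := torus_consts N
  have hK₀ := K₀_four (N := N)
  have h := muDeriv_locE_le_of_coresAt_pencil_mass (tsys 4 N) (tgeometry 4 N) 𝔊 hroom hm hN hq hg hO hH hscale hact
    (R := R) (b₅ := 5 * r₁) (X₀ := X₀) (sμ := sμ) hA hr₁ (le_of_eq (by ring)) (by rw [hκ]; exact hrate)
    (by rw [hK₀, hν, hc]; exact hsmall) hM3 h01 hμ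
  rw [hν, hc, hK₀] at h
  exact h

end Dep

/-! ## §2 THE SUBSTRATE'S SLOT ACTIVITIES ON THE TORUS -/

section Slot

variable {C : Carriers} (P : MeasPotFrame C) (Op : Type*) [NormedAddCommGroup Op] [NormedSpace ℂ Op] {Pol J : Type*}
  (𝒴 : Pol → J → Type) [∀ Z j, Fintype (𝒴 Z j)] (dom : ∀ Z j, 𝒴 Z j → C.Dom)
  (Jc : Pol → J → Type) [∀ Z j, Fintype (Jc Z j)]
  (V : Pol → J → Type) [∀ Z j, NormedAddCommGroup (V Z j)] [∀ Z j, InnerProductSpace ℝ (V Z j)]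
  [∀ Z j, MeasurableSpace (V Z j)] [∀ Z j, BorelSpace (V Z j)] [∀ Z j, FiniteDimensional ℝ (V Z j)]

open Classical in
/-- **HOLOMORPHY IN THE SOURCE + THE (2.41) ENVELOPE OF THE DRESSED OUTPUT OF THE SLOT ACTIVITIES, ON THE TORUS — NO GEOMETRY
HYPOTHESIS** (kernel; S33 §4 `analytic_and_bounded_locE_of_actOfLetters` ONCE BY NAME at `tgeometry 4 N`, constants located). [folklore] -/
theorem analytic_and_bounded_locE_of_actOfLetters_torus {W : Set (ℕ → ℝ)}
    {ctr : ℕ → (ℕ → ℝ) → C.BgB → Op × B13HistM P} {ROp RHist R' : ℕ → ℝ} (ℓ : ∀ Z j, CoreLetters P Op 𝒴 dom Jc V Z j)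
    {mq bq N₀ : ℕ → Pol × J → C.Dom → ℝ} (hroom : ∀ k, ROp k < R' k)
    (hm : ∀ k, ∀ g ∈ W, ∀ (U : C.BgB) (X : C.Dom), C.scale X = k → ∀ p, 0 < mq k p X)
    (hN : ∀ k, ∀ g ∈ W, ∀ (U : C.BgB) (X : C.Dom), C.scale X = k → ∀ p : Pol × J,
      (∀ o ∈ ball (ctr k g U).1 (R' k),
        AEStronglyMeasurable ((ℓ p.1 p.2).N o) (coreOf P Op 𝒴 dom Jc V ℓ p.1 p.2).lam) ∧
      (∀ a, DifferentiableOn ℂ (fun o => (ℓ p.1 p.2).N o a) (ball (ctr k g U).1 (R' k))) ∧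
      (∀ o ∈ ball (ctr k g U).1 (R' k), ∀ a, ‖(ℓ p.1 p.2).N o a‖ ≤ N₀ k p X))
    (hq : ∀ k, ∀ g ∈ W, ∀ (U : C.BgB) (X : C.Dom), C.scale X = k → ∀ p : Pol × J,
      (∀ o ∈ ball (ctr k g U).1 (R' k),
        AEStronglyMeasurable (Function.uncurry ((ℓ p.1 p.2).q o))
          ((coreOf P Op 𝒴 dom Jc V ℓ p.1 p.2).lam.prod volume)) ∧
      (∀ a v, DifferentiableOn ℂ (fun o => (ℓ p.1 p.2).q o a v) (ball (ctr k g U).1 (R' k))) ∧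
      (∀ o ∈ ball (ctr k g U).1 (R' k), ∀ a v, mq k p X * ‖v‖ ^ 2 - bq k p X ≤ ((ℓ p.1 p.2).q o a v).re))
    {k : ℕ} {g : ℕ → ℝ} (hg : g ∈ W) {U : C.BgB} {o : Op} {h₀ v : B13HistM P} {μ₁ : ℝ}
    (hO : ‖o - (ctr k g U).1‖ ≤ ROp k) (hH : ‖h₀ - (ctr k g U).2‖ + μ₁ * ‖v‖ ≤ RHist k)
    {emb : (tsys 4 N).Dom → C.Dom} (hscale : ∀ Z, C.scale (emb Z) = k) (terms : (tsys 4 N).Dom → Finset (Pol × J))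
    {A R r₁ : ℝ} (X₀ : (tsys 4 N).Dom) (hA : 0 ≤ A) (hr₁ : 0 ≤ r₁)
    (hrate : r₁ + 2 * (64 * Real.log 162) + 2 ≤ R) (hsmall : A * Real.exp (5 * r₁ + 1) * K₀ 64 8 * 9 * 64 ≤ 1)
    (hM3 : ∀ Z : (tsys 4 N).Dom, Z.1 ⊆ X₀.1 →
      ∑ p ∈ terms Z, (coreOf P Op 𝒴 dom Jc V ℓ p.1 p.2).lam.real univ *
          ((coreOf P Op 𝒴 dom Jc V ℓ p.1 p.2).wB * N₀ k p (emb Z) * Real.exp (bq k p (emb Z))) *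
          (Real.pi / (mq k p (emb Z) / 2)) ^ (Module.finrank ℝ (V p.1 p.2) / 2 : ℝ) *
        Real.exp ((coreOf P Op 𝒴 dom Jc V ℓ p.1 p.2).N₁ * (‖h₀‖ + μ₁ * ‖v‖)) ≤ A * Real.exp (-(R * torusTreeLen Z.1))) :
    DifferentiableOn ℂ (fun s => locE (TTouch (d := 4) (N := N)) (fun Z : (tsys 4 N).Dom => Z.1)
        (fun Z => ∑ p ∈ terms Z, actOfLetters P Op 𝒴 dom Jc V ℓ p.1 p.2 o (h₀ + s • v)) X₀.1) (ball (0 : ℂ) μ₁) ∧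
      ∀ s ∈ ball (0 : ℂ) μ₁, ‖locE (TTouch (d := 4) (N := N)) (fun Z : (tsys 4 N).Dom => Z.1)
          (fun Z => ∑ p ∈ terms Z, actOfLetters P Op 𝒴 dom Jc V ℓ p.1 p.2 o (h₀ + s • v)) X₀.1‖ ≤
        Real.exp 1 * 9 * 64 * K₀ 64 8 ^ 2 * A * Real.exp (-(r₁ * torusTreeLen X₀.1)) := by
  obtain ⟨hν, hκ, hc⟩ := torus_consts N
  have hK₀ := K₀_four (N := N)
  have h := analytic_and_bounded_locE_of_actOfLetters P Op 𝒴 dom Jc V (tsys 4 N) (tgeometry 4 N) ℓ hroom hm hN hq hg hO hH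
    hscale terms (R := R) (b₅ := 5 * r₁) (X₀ := X₀) hA hr₁ (le_of_eq (by ring)) (by rw [hκ]; exact hrate)
    (by rw [hK₀, hν, hc]; exact hsmall) hM3
  rw [hν, hc, hK₀] at h
  exact h

open Classical in
/-- **LINEAR RESPONSE OF THE DRESSED OUTPUT OF THE SLOT ACTIVITIES, ON THE TORUS — NO GEOMETRY HYPOTHESIS** (kernel; S33 §4
`muDeriv_locE_le_of_actOfLetters` ONCE BY NAME at `tgeometry 4 N`, constants located): for `‖sμ‖ ≤ μ₀ < μ₁`, the source derivative of
`s ↦ E[Σ actOfLetters … o (h₀ + s • v)](X₀)` at `sμ` is `≤ 2·(e·9·64·K₀(64,8)²·A·e^{−r₁·torusTreeLen X₀})∕(μ₁ − μ₀)`. [folklore] -/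
theorem muDeriv_locE_le_of_actOfLetters_torus {W : Set (ℕ → ℝ)}
    {ctr : ℕ → (ℕ → ℝ) → C.BgB → Op × B13HistM P} {ROp RHist R' : ℕ → ℝ} (ℓ : ∀ Z j, CoreLetters P Op 𝒴 dom Jc V Z j)
    {mq bq N₀ : ℕ → Pol × J → C.Dom → ℝ} (hroom : ∀ k, ROp k < R' k)
    (hm : ∀ k, ∀ g ∈ W, ∀ (U : C.BgB) (X : C.Dom), C.scale X = k → ∀ p, 0 < mq k p X)
    (hN : ∀ k, ∀ g ∈ W, ∀ (U : C.BgB) (X : C.Dom), C.scale X = k → ∀ p : Pol × J,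
      (∀ o ∈ ball (ctr k g U).1 (R' k),
        AEStronglyMeasurable ((ℓ p.1 p.2).N o) (coreOf P Op 𝒴 dom Jc V ℓ p.1 p.2).lam) ∧
      (∀ a, DifferentiableOn ℂ (fun o => (ℓ p.1 p.2).N o a) (ball (ctr k g U).1 (R' k))) ∧
      (∀ o ∈ ball (ctr k g U).1 (R' k), ∀ a, ‖(ℓ p.1 p.2).N o a‖ ≤ N₀ k p X))
    (hq : ∀ k, ∀ g ∈ W, ∀ (U : C.BgB) (X : C.Dom), C.scale X = k → ∀ p : Pol × J,
      (∀ o ∈ ball (ctr k g U).1 (R' k),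
        AEStronglyMeasurable (Function.uncurry ((ℓ p.1 p.2).q o))
          ((coreOf P Op 𝒴 dom Jc V ℓ p.1 p.2).lam.prod volume)) ∧
      (∀ a v, DifferentiableOn ℂ (fun o => (ℓ p.1 p.2).q o a v) (ball (ctr k g U).1 (R' k))) ∧
      (∀ o ∈ ball (ctr k g U).1 (R' k), ∀ a v, mq k p X * ‖v‖ ^ 2 - bq k p X ≤ ((ℓ p.1 p.2).q o a v).re))
    {k : ℕ} {g : ℕ → ℝ} (hg : g ∈ W) {U : C.BgB} {o : Op} {h₀ v : B13HistM P} {μ₁ : ℝ}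
    (hO : ‖o - (ctr k g U).1‖ ≤ ROp k) (hH : ‖h₀ - (ctr k g U).2‖ + μ₁ * ‖v‖ ≤ RHist k)
    {emb : (tsys 4 N).Dom → C.Dom} (hscale : ∀ Z, C.scale (emb Z) = k) (terms : (tsys 4 N).Dom → Finset (Pol × J))
    {A R r₁ μ₀ : ℝ} (X₀ : (tsys 4 N).Dom) {sμ : ℂ} (hA : 0 ≤ A) (hr₁ : 0 ≤ r₁)
    (hrate : r₁ + 2 * (64 * Real.log 162) + 2 ≤ R) (hsmall : A * Real.exp (5 * r₁ + 1) * K₀ 64 8 * 9 * 64 ≤ 1)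
    (hM3 : ∀ Z : (tsys 4 N).Dom, Z.1 ⊆ X₀.1 →
      ∑ p ∈ terms Z, (coreOf P Op 𝒴 dom Jc V ℓ p.1 p.2).lam.real univ *
          ((coreOf P Op 𝒴 dom Jc V ℓ p.1 p.2).wB * N₀ k p (emb Z) * Real.exp (bq k p (emb Z))) *
          (Real.pi / (mq k p (emb Z) / 2)) ^ (Module.finrank ℝ (V p.1 p.2) / 2 : ℝ) *
        Real.exp ((coreOf P Op 𝒴 dom Jc V ℓ p.1 p.2).N₁ * (‖h₀‖ + μ₁ * ‖v‖)) ≤ A * Real.exp (-(R * torusTreeLen Z.1)))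
    (h01 : μ₀ < μ₁) (hμ : ‖sμ‖ ≤ μ₀) :
    ‖deriv (fun s => locE (TTouch (d := 4) (N := N)) (fun Z : (tsys 4 N).Dom => Z.1)
        (fun Z => ∑ p ∈ terms Z, actOfLetters P Op 𝒴 dom Jc V ℓ p.1 p.2 o (h₀ + s • v)) X₀.1) sμ‖ ≤
      2 * (Real.exp 1 * 9 * 64 * K₀ 64 8 ^ 2 * A * Real.exp (-(r₁ * torusTreeLen X₀.1))) / (μ₁ - μ₀) := by
  obtain ⟨hν, hκ, hc⟩ := torus_consts N
  have hK₀ := K₀_four (N := N)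
  have h := muDeriv_locE_le_of_actOfLetters P Op 𝒴 dom Jc V (tsys 4 N) (tgeometry 4 N) ℓ hroom hm hN hq hg hO hH hscale terms
    (R := R) (b₅ := 5 * r₁) (X₀ := X₀) (sμ := sμ) hA hr₁ (le_of_eq (by ring)) (by rw [hκ]; exact hrate)
    (by rw [hK₀, hν, hc]; exact hsmall) hM3 h01 hμ
  rw [hν, hc, hK₀] at h
  exact h

end Slot

end Summit.QuantumFields.BalabanUV.T4Continuum.NE1p.DressedSourceAnalyticOnCoresTorus

end
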